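import Summits.QuantumFields.QCD.Theses.SpectralDefectExtinction
import Summits.QuantumFields.QCD.Theorems.SpectralDefectExtinctionWindowExtinctionCornerResonanceLDAux
import Summits.QuantumFields.QCD.Theorems.SpectralDefectExtinctionTipPricingStubCountMeasurable
import Literature.MathematicalPhysics.QuantumFieldTheory.QCDPhaseQuenched
import Literature.MathematicalPhysics.QuantumFieldTheory.TorusFreeTransfer

/-!
# Stub `stub_resonanceLD` (S2d) of line `corner-decorrelation-deep-hole` — resonance large deviation on a box
(crux `Summit.QuantumFields.QCD.Theses.SpectralDefectExtinction.WindowExtinction`, item stmt-QuantumFields-18063)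

**Probability stub (registered signature, proved from S2c by name).**  The single-link resonance
anti-concentration S2c (integrated form, product Haar with the full weight `W = e^{−βS_W}∏_f|det D_W|`, test
functions blind to the resampled link) implies: there are `κ₀, c, C > 0` such that for `N_f ≤ 3`, `β ≥ 1`,
any torus, any masses, `2 ≤ ℓ`, `2ℓ ≤ L`, any integer box `∏[a_i, a_i + m_i)` with `ℓ ≤ m_i < 2ℓ`, any phase
`φ₀` and width `0 < ε ≤ √(κ₀/β)`, the phase-quenched probability that at least `1/16` of the box's points `v`
carry a plaquette `ρ(U_{P₀₁(proj v)})` with a characteristic root within `ε` of `e^{iφ₀}` is `≤ C e^{−cℓ⁴}`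
(multiplied out against the `∏_f|det|` weight).

Proof (the generic machinery is the landed auxiliary file `…CornerResonanceLDAux`):
* `wilsonMeasure = Z⁻¹ e^{−βS_W} · Haar^{⊗E}` (`wilsonExpectation_eq_div_integral`), so both sides are
  product-Haar integrals against `W`, divided by the same `Z > 0`;
* `cornerLD_generic` (parity classes `v ↦ v mod 2`, `16` of them, each of size `≥ ℓ⁴/256` by
  `cornerLD_pow_le_card_class`; peeling constant `δ = C_{S2c}√β ε ≤ C_{S2c}√κ₀ ≤ 2⁻¹⁷`) gives the bound
  `16 e^{−ℓ⁴/1024} ∫ W` once its one-site hypothesis is verified;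
* the one-site hypothesis is S2c at the site `z = proj v` with the test function
  `G = ∏_{u ∈ S'}(1 + (2¹⁶−1)·1_{res u})`, `S'` inside the class of `v` and avoiding `v`: `G` is measurable,
  bounded, and BLIND to the link `(proj v, 0)` because the plaquette `P₀₁(proj u)` uses the `0`-links at
  `proj u` and `proj u + 1̂` only, and `proj u ∉ {proj v, proj v − 1̂}` for distinct points of one parity
  class of a box of sides `< 2ℓ ≤ L` (`cornerLD_proj_ne`).
Constants: `κ₀ = min 1 (2¹⁷ C_{S2c})⁻²`, `c = 1/1024`, `C = 16`.
-/

noncomputable section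

namespace Summit.QuantumFields.QCD.Cruxes.WindowExtinction.CornerDecorrelationDeepHole

open scoped BigOperators Topology Classical Matrix
open Filter MeasureTheory
open Literature.MathematicalPhysics.QuantumLattice Literature.MathematicalPhysics.QuantumFieldTheory
  Literature.Probability.LatticeModels
open Summit.QuantumFields.QCD.Theses.SpectralDefectExtinction
open Summit.QuantumFields.QCD.Cruxes.TipPricing.HermitianFlowCoarea (countMeas_measurable_countP)

/-! ## Link locality of the `(0,1)`-plaquette -/

/-- Resampling the link `(z, 0)` does not change the plaquette `P₀₁(y)` unless `y = z` or `y + 1̂ = z`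
(the plaquette uses the `0`-links at `y` and at `y + 1̂` only). -/
theorem cornerLD_plaquetteHolonomy_update {L : ℕ} (U : GaugeConfig 4 L SU3) (z y : TorusSite 4 L)
    (g : SU3) (h1 : y ≠ z) (h2 : y + Pi.single 1 1 ≠ z) :
    plaquetteHolonomy (Function.update U (z, 0) g) y 0 1 = plaquetteHolonomy U y 0 1 := by
  unfold plaquetteHolonomy
  have h10 : (1 : Fin 4) ≠ 0 := by decide
  have e1 : Function.update U (z, 0) g (y, 0) = U (y, 0) :=
    Function.update_of_ne (fun h => h1 (congrArg Prod.fst h)) _ _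
  have e2 : Function.update U (z, 0) g (Site.shift y 0, 1) = U (Site.shift y 0, 1) :=
    Function.update_of_ne (fun h => h10 (congrArg Prod.snd h)) _ _
  have e3 : Function.update U (z, 0) g (Site.shift y 1, 0) = U (Site.shift y 1, 0) :=
    Function.update_of_ne (fun h => h2 (congrArg Prod.fst h)) _ _
  have e4 : Function.update U (z, 0) g (y, 1) = U (y, 1) :=
    Function.update_of_ne (fun h => h10 (congrArg Prod.snd h)) _ _
  rw [e1, e2, e3, e4]

/-! ## Measurability of the resonance indicator -/

/-- The resonance indicator `1[ρ(U_{P₀₁(proj v)}) has a characteristic root within ε of e^{iφ₀}]` is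
measurable in the gauge field. -/
theorem cornerLD_measurable_resIndicator (L : ℕ) [NeZero L] (v : Fin 4 → ℤ) (φ₀ ε : ℝ) :
    Measurable fun U : GaugeConfig 4 L SU3 =>
      if 1 ≤ Multiset.countP (fun w : ℂ => ‖w - Complex.exp (↑φ₀ * Complex.I)‖ ≤ ε)
          (fundamentalRep (Fin 3) (plaquetteHolonomy U (Torus.proj L v) 0 1)).charpoly.roots
      then (1 : ℝ) else 0 := by
  have hA : Continuous fun U : GaugeConfig 4 L SU3 =>
      fundamentalRep (Fin 3) (plaquetteHolonomy U (Torus.proj L v) 0 1) :=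
    (continuous_fundamentalRep (Fin 3)).comp (by unfold plaquetteHolonomy; fun_prop)
  have hcnt : Measurable fun U : GaugeConfig 4 L SU3 =>
      Multiset.countP (fun w : ℂ => ‖w - Complex.exp (↑φ₀ * Complex.I)‖ ≤ ε)
        (fundamentalRep (Fin 3) (plaquetteHolonomy U (Torus.proj L v) 0 1)).charpoly.roots :=
    countMeas_measurable_countP hA _ (fun _ => {w : ℂ | ‖w - Complex.exp (↑φ₀ * Complex.I)‖ ≤ ε})
      (fun _ => isClosed_le (continuous_id.sub continuous_const).norm continuous_const)
      (fun _ _ _ => le_rfl) (fun z => ⟨fun h => ⟨0, h⟩, fun ⟨_, h⟩ => h⟩)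
  exact Measurable.ite (hcnt (MeasurableSet.of_discrete (s := {j : ℕ | 1 ≤ j})))
    measurable_const measurable_const

/-! ## The stub -/

/-- **S2d · RESONANCE LARGE DEVIATION ON A BOX** (registered stub `stub_resonanceLD` of line
`corner-decorrelation-deep-hole`, crux `WindowExtinction`, item stmt-QuantumFields-18063).  `S2c →` there are
`κ₀, c, C > 0` such that for `N_f ≤ 3`, `β ≥ 1`, any torus, any masses, `2 ≤ ℓ`, `2ℓ ≤ L`, any integer box
`∏[a_i, a_i + m_i)` with `ℓ ≤ m_i < 2ℓ`, any phase `φ₀` and width `0 < ε ≤ √(κ₀/β)`: the phase-quenched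
probability that at least `1/16` of the box's points `v` have `ρ(U_{P₀₁(proj v)})` with a root within `ε` of
`e^{iφ₀}` is `≤ C e^{−cℓ⁴}`. -/
theorem stub_resonanceLD :
    (∃ C : ℝ, 0 < C ∧ ∀ Nf : ℕ, Nf ≤ 3 → ∀ β : ℝ, 1 ≤ β → ∀ (L : ℕ) [NeZero L], 2 ≤ L →
∀ (μ : Fin Nf → ℝ) (z : TorusSite 4 L) (φ₀ ε : ℝ), 0 < ε → ε ≤ 1 →
∀ (G : GaugeConfig 4 L SU3 → ℝ) (B : ℝ), Measurable G → (∀ U, 0 ≤ G U ∧ G U ≤ B) →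
(∀ (U : GaugeConfig 4 L SU3) (g : SU3), G (Function.update U (z, 0) g) = G U) →
∫ U, G U * (if 1 ≤ Multiset.countP (fun w : ℂ => ‖w - Complex.exp (↑φ₀ * Complex.I)‖ ≤ ε)
(fundamentalRep (Fin 3) (plaquetteHolonomy U z 0 1)).charpoly.roots then (1 : ℝ) else 0) *
(Real.exp (-(β * wilsonAction (fundamentalRep (Fin 3)) U)) *
∏ f, ‖fermionDet (wilsonDirac (fundamentalRep (Fin 3)) U (μ f) 1)‖)
∂(Measure.pi fun _ : Edge 4 L => haarProbability SU3) ≤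
C * Real.sqrt β * ε *
∫ U, G U * (Real.exp (-(β * wilsonAction (fundamentalRep (Fin 3)) U)) *
∏ f, ‖fermionDet (wilsonDirac (fundamentalRep (Fin 3)) U (μ f) 1)‖)
∂(Measure.pi fun _ : Edge 4 L => haarProbability SU3)) →
    ∃ κ₀ c C : ℝ, 0 < κ₀ ∧ 0 < c ∧ 0 < C ∧ ∀ Nf : ℕ, Nf ≤ 3 → ∀ β : ℝ, 1 ≤ β → ∀ (L : ℕ) [NeZero L],
    ∀ (μ : Fin Nf → ℝ) (ℓ : ℕ), 2 ≤ ℓ → 2 * ℓ ≤ L → ∀ (a : Fin 4 → ℤ) (m : Fin 4 → ℕ),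
    (∀ i, ℓ ≤ m i ∧ m i < 2 * ℓ) → ∀ (φ₀ ε : ℝ), 0 < ε → ε ≤ Real.sqrt (κ₀ / β) →
    ∫ U : GaugeConfig 4 L SU3,
    (if (∏ i, m i) ≤ 16 * ((Fintype.piFinset fun i => Finset.Ico (a i) (a i + m i)).filter
    (fun v => 1 ≤ Multiset.countP (fun w : ℂ => ‖w - Complex.exp (↑φ₀ * Complex.I)‖ ≤ ε)
    (fundamentalRep (Fin 3) (plaquetteHolonomy U (Torus.proj L v) 0 1)).charpoly.roots)).card
    then (1 : ℝ) else 0) *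
    ∏ f, ‖fermionDet (wilsonDirac (fundamentalRep (Fin 3)) U (μ f) 1)‖ ∂(wilsonMeasure (fundamentalRep (Fin 3)) β) ≤
    C * Real.exp (-(c * (ℓ : ℝ) ^ 4)) *
    ∫ U : GaugeConfig 4 L SU3, ∏ f, ‖fermionDet (wilsonDirac (fundamentalRep (Fin 3)) U (μ f) 1)‖
    ∂(wilsonMeasure (fundamentalRep (Fin 3)) β) := by
  intro hSL
  obtain ⟨C, hC, hSL⟩ := hSL
  refine ⟨min 1 ((1 / (2 ^ 17 * C)) ^ 2), 1 / 1024, 16, lt_min one_pos (by positivity), by norm_num,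
    by norm_num, ?_⟩
  intro Nf hNf β hβ L _ μ ℓ hℓ h2ℓ a m hm φ₀ ε hε hεκ
  have hβ0 : 0 < β := by linarith
  have hβne : β ≠ 0 := hβ0.ne'
  have hCne : C ≠ 0 := hC.ne'
  have hL2 : 2 ≤ L := by omega
  have hρ : Continuous (fundamentalRep (Fin 3)) := continuous_fundamentalRep (Fin 3)
  -- `ε ≤ 1` and the peeling constant `δ = C √β ε ≤ 2⁻¹⁷`
  have hκle1 : min 1 ((1 / (2 ^ 17 * C)) ^ 2) ≤ 1 := min_le_left _ _
  have hκle2 : min 1 ((1 / (2 ^ 17 * C)) ^ 2) ≤ (1 / (2 ^ 17 * C)) ^ 2 := min_le_right _ _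
  have hε1 : ε ≤ 1 :=
    calc ε ≤ Real.sqrt (min 1 ((1 / (2 ^ 17 * C)) ^ 2) / β) := hεκ
      _ ≤ Real.sqrt 1 := Real.sqrt_le_sqrt ((div_le_one hβ0).2 (hκle1.trans hβ))
      _ = 1 := Real.sqrt_one
  obtain ⟨δ, hδdef⟩ : ∃ δ : ℝ, δ = C * Real.sqrt β * ε := ⟨_, rfl⟩
  have hδ0 : 0 ≤ δ := by rw [hδdef]; positivity
  have hδ : δ ≤ 1 / 2 ^ 17 := by
    have h1 : Real.sqrt β * ε ≤ Real.sqrt β * Real.sqrt (min 1 ((1 / (2 ^ 17 * C)) ^ 2) / β) :=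
      mul_le_mul_of_nonneg_left hεκ (Real.sqrt_nonneg _)
    have h2 : Real.sqrt β * Real.sqrt (min 1 ((1 / (2 ^ 17 * C)) ^ 2) / β) =
        Real.sqrt (min 1 ((1 / (2 ^ 17 * C)) ^ 2)) := by
      rw [← Real.sqrt_mul hβ0.le, ← mul_div_assoc, mul_div_cancel_left₀ _ hβne]
    have h3 : Real.sqrt (min 1 ((1 / (2 ^ 17 * C)) ^ 2)) ≤ 1 / (2 ^ 17 * C) := by
      rw [Real.sqrt_le_left (by positivity)]
      exact hκle2
    have h4 : Real.sqrt β * ε ≤ 1 / (2 ^ 17 * C) := by rw [h2] at h1; exact h1.trans h3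
    calc δ = C * (Real.sqrt β * ε) := by rw [hδdef]; ring
      _ ≤ C * (1 / (2 ^ 17 * C)) := mul_le_mul_of_nonneg_left h4 hC.le
      _ = 1 / 2 ^ 17 := by rw [mul_one_div, div_mul_eq_div_div_swap, div_self hCne]
  -- the product Haar measure and the full weight
  obtain ⟨π, hπ⟩ : ∃ π : Measure (GaugeConfig 4 L SU3), π = Measure.pi fun _ : Edge 4 L => haarProbability SU3 :=
    ⟨_, rfl⟩
  obtain ⟨w, hw⟩ : ∃ w : GaugeConfig 4 L SU3 → ℝ,
      w = fun U => ∏ f, ‖fermionDet (wilsonDirac (fundamentalRep (Fin 3)) U (μ f) 1)‖ := ⟨_, rfl⟩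
  obtain ⟨Wt, hWt⟩ : ∃ Wt : GaugeConfig 4 L SU3 → ℝ,
      Wt = fun U => Real.exp (-(β * wilsonAction (fundamentalRep (Fin 3)) U)) * w U := ⟨_, rfl⟩
  have hW0 : ∀ U, 0 ≤ Wt U := fun U => by
    simp only [hWt, hw]
    exact mul_nonneg (Real.exp_pos _).le (Finset.prod_nonneg fun f _ => norm_nonneg _)
  have hWc : Continuous Wt := by
    simp only [hWt, hw]
    refine (Real.continuous_exp.comp ((continuous_wilsonAction (fundamentalRep (Fin 3)) hρ).const_mul
      β).neg).mul (continuous_finsetProd _ fun f _ => ?_)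
    exact ((continuous_wilsonDirac (fundamentalRep (Fin 3)) hρ (μ f) 1).matrix_det).norm
  have hWi : Integrable Wt π := by
    rw [hπ]
    exact hWc.integrable_of_hasCompactSupport (HasCompactSupport.of_compactSpace _)
  -- the box and its parity classes
  obtain ⟨Bx, hBx⟩ : ∃ Bx : Finset (Fin 4 → ℤ),
      Bx = Fintype.piFinset fun i : Fin 4 => Finset.Ico (a i) (a i + (m i : ℤ)) := ⟨_, rfl⟩
  obtain ⟨cls, hcls⟩ : ∃ cls : (Fin 4 → ℤ) → (Fin 4 → ZMod 2), cls = fun v i => ((v i : ℤ) : ZMod 2) :=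
    ⟨_, rfl⟩
  have hclsi : ∀ v i, cls v i = ((v i : ℤ) : ZMod 2) := fun v i => by rw [hcls]
  have hbm : ∀ u : Fin 4 → ℤ, Measurable fun U : GaugeConfig 4 L SU3 =>
      if 1 ≤ Multiset.countP (fun w : ℂ => ‖w - Complex.exp (↑φ₀ * Complex.I)‖ ≤ ε)
            (fundamentalRep (Fin 3) (plaquetteHolonomy U (Torus.proj L u) 0 1)).charpoly.roots then (1 : ℝ) else 0 :=
    fun u => cornerLD_measurable_resIndicator L u φ₀ ε
  have hK : Bx.card ≤ ∏ i, m i := by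
    rw [hBx, Fintype.card_piFinset]
    refine le_of_eq (Finset.prod_congr rfl fun i _ => ?_)
    rw [Int.card_Ico]
    simp
  have hΛ : ∀ r, ((ℓ : ℝ) ^ 4) ≤ 256 * ((Bx.filter (fun v => cls v = r)).card : ℝ) := by
    intro r
    have h := cornerLD_pow_le_card_class a m hℓ (fun i => (hm i).1) cls hclsi r
    rw [hBx]
    exact_mod_cast h
  -- the one-site hypothesis from S2c
  have hyp : ∀ r, ∀ v ∈ Bx.filter (fun v => cls v = r), ∀ S' ⊆ Bx.filter (fun v => cls v = r), v ∉ S' →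
      ∫ x, (∏ u ∈ S', (1 + ((2 : ℝ) ^ 16 - 1) * (if 1 ≤ Multiset.countP (fun w : ℂ => ‖w - Complex.exp (↑φ₀ * Complex.I)‖ ≤ ε)
            (fundamentalRep (Fin 3) (plaquetteHolonomy x (Torus.proj L u) 0 1)).charpoly.roots then (1 : ℝ) else 0))) *
          (if 1 ≤ Multiset.countP (fun w : ℂ => ‖w - Complex.exp (↑φ₀ * Complex.I)‖ ≤ ε)
            (fundamentalRep (Fin 3) (plaquetteHolonomy x (Torus.proj L v) 0 1)).charpoly.roots then (1 : ℝ) else 0) * Wt x ∂π ≤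
        δ * ∫ x, (∏ u ∈ S', (1 + ((2 : ℝ) ^ 16 - 1) * (if 1 ≤ Multiset.countP (fun w : ℂ => ‖w - Complex.exp (↑φ₀ * Complex.I)‖ ≤ ε)
            (fundamentalRep (Fin 3) (plaquetteHolonomy x (Torus.proj L u) 0 1)).charpoly.roots then (1 : ℝ) else 0))) * Wt x ∂π := by
    intro r v hv S' hS' hvS'
    have ht : (0 : ℝ) ≤ (2 : ℝ) ^ 16 - 1 := by norm_num
    obtain ⟨hGm, hG0, hGle⟩ := cornerLD_prod_facts
      (fun (u : Fin 4 → ℤ) (U : GaugeConfig 4 L SU3) => 1 ≤ Multiset.countP (fun w : ℂ => ‖w - Complex.exp (↑φ₀ * Complex.I)‖ ≤ ε)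
            (fundamentalRep (Fin 3) (plaquetteHolonomy U (Torus.proj L u) 0 1)).charpoly.roots) ht hbm S'
    have hvB : v ∈ Bx := (Finset.mem_filter.1 hv).1
    have hvr : cls v = r := (Finset.mem_filter.1 hv).2
    -- the test function does not see the link `(proj v, 0)`
    have hblind : ∀ (U : GaugeConfig 4 L SU3) (g : SU3),
        (∏ u ∈ S', (1 + ((2 : ℝ) ^ 16 - 1) *
          (if 1 ≤ Multiset.countP (fun w : ℂ => ‖w - Complex.exp (↑φ₀ * Complex.I)‖ ≤ ε)
            (fundamentalRep (Fin 3) (plaquetteHolonomy (Function.update U (Torus.proj L v, 0) g) (Torus.proj L u) 0 1)).charpoly.roots then (1 : ℝ) else 0))) =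
          ∏ u ∈ S', (1 + ((2 : ℝ) ^ 16 - 1) * (if 1 ≤ Multiset.countP (fun w : ℂ => ‖w - Complex.exp (↑φ₀ * Complex.I)‖ ≤ ε)
            (fundamentalRep (Fin 3) (plaquetteHolonomy U (Torus.proj L u) 0 1)).charpoly.roots then (1 : ℝ) else 0)) := by
      intro U g
      refine Finset.prod_congr rfl fun u hu => ?_
      have huB : u ∈ Bx := (Finset.mem_filter.1 (hS' hu)).1
      have hur : cls u = r := (Finset.mem_filter.1 (hS' hu)).2
      have hne : v ≠ u := fun h => hvS' (h ▸ hu)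
      rw [hBx] at hvB huB
      obtain ⟨hn1, hn2⟩ := cornerLD_proj_ne h2ℓ a m (fun i => (hm i).2) cls hclsi hvB huB
        (hvr.trans hur.symm) hne
      have hplaq : plaquetteHolonomy (Function.update U (Torus.proj L v, 0) g) (Torus.proj L u) 0 1 =
          plaquetteHolonomy U (Torus.proj L u) 0 1 :=
        cornerLD_plaquetteHolonomy_update U _ _ g (Ne.symm hn1) (fun h => hn2 h.symm)
      simp only [hplaq]
    have h := hSL Nf hNf β hβ L hL2 μ (Torus.proj L v) φ₀ ε hε hε1
      (fun U => ∏ u ∈ S', (1 + ((2 : ℝ) ^ 16 - 1) * (if 1 ≤ Multiset.countP (fun w : ℂ => ‖w - Complex.exp (↑φ₀ * Complex.I)‖ ≤ ε)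
            (fundamentalRep (Fin 3) (plaquetteHolonomy U (Torus.proj L u) 0 1)).charpoly.roots then (1 : ℝ) else 0)))
      ((1 + ((2 : ℝ) ^ 16 - 1)) ^ S'.card) hGm (fun U => ⟨hG0 U, hGle U⟩) hblind
    simp only [hWt, hw, hδdef, hπ]
    simpa only [mul_assoc] using h
  -- the generic large deviation bound, in product-Haar form
  have hgen := cornerLD_generic (μ := π) hW0 hWi
    (fun (u : Fin 4 → ℤ) (U : GaugeConfig 4 L SU3) => 1 ≤ Multiset.countP (fun w : ℂ => ‖w - Complex.exp (↑φ₀ * Complex.I)‖ ≤ ε)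
            (fundamentalRep (Fin 3) (plaquetteHolonomy U (Torus.proj L u) 0 1)).charpoly.roots) hbm Bx cls hδ0 hδ hK hΛ hyp
  have h16 : (Fintype.card (Fin 4 → ZMod 2) : ℝ) = 16 := by
    rw [Fintype.card_fun, ZMod.card, Fintype.card_fin]
    norm_num
  rw [h16] at hgen
  -- transport to the Wilson measure
  have hZ0 : 0 ≤ ∫ U, Real.exp (-β * wilsonAction (fundamentalRep (Fin 3)) U) ∂π :=
    integral_nonneg fun U => (Real.exp_pos _).le
  have conv : ∀ F : GaugeConfig 4 L SU3 → ℝ,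
      ∫ U, F U ∂(wilsonMeasure (fundamentalRep (Fin 3)) β) =
        (∫ U, F U * Real.exp (-β * wilsonAction (fundamentalRep (Fin 3)) U) ∂π) /
          ∫ U, Real.exp (-β * wilsonAction (fundamentalRep (Fin 3)) U) ∂π := fun F => by
    rw [hπ]
    exact wilsonExpectation_eq_div_integral (d := 4) (G := SU3) (ρ := fundamentalRep (Fin 3)) hρ β F
  rw [conv, conv, ← mul_div_assoc]
  refine div_le_div_of_nonneg_right ?_ hZ0
  have e1 : ∀ U : GaugeConfig 4 L SU3,
      (if (∏ i, m i) ≤ 16 * ((Fintype.piFinset fun i : Fin 4 => Finset.Ico (a i) (a i + (m i : ℤ))).filter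
          (fun v => 1 ≤ Multiset.countP (fun w : ℂ => ‖w - Complex.exp (↑φ₀ * Complex.I)‖ ≤ ε)
            (fundamentalRep (Fin 3) (plaquetteHolonomy U (Torus.proj L v) 0 1)).charpoly.roots)).card then (1 : ℝ) else 0) *
        (∏ f, ‖fermionDet (wilsonDirac (fundamentalRep (Fin 3)) U (μ f) 1)‖) *
        Real.exp (-β * wilsonAction (fundamentalRep (Fin 3)) U) =
      (if (∏ i, m i) ≤ 16 * (Bx.filter (fun v => 1 ≤ Multiset.countP (fun w : ℂ => ‖w - Complex.exp (↑φ₀ * Complex.I)‖ ≤ ε)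
            (fundamentalRep (Fin 3) (plaquetteHolonomy U (Torus.proj L v) 0 1)).charpoly.roots)).card then (1 : ℝ) else 0) * Wt U := by
    intro U
    simp only [hWt, hw, hBx, neg_mul]
    ring
  have e2 : ∀ U : GaugeConfig 4 L SU3,
      (∏ f, ‖fermionDet (wilsonDirac (fundamentalRep (Fin 3)) U (μ f) 1)‖) *
        Real.exp (-β * wilsonAction (fundamentalRep (Fin 3)) U) = Wt U := by
    intro U
    simp only [hWt, hw, neg_mul]
    ring
  simp_rw [e1, e2]
  exact hgen

end Summit.QuantumFields.QCD.Cruxes.WindowExtinction.CornerDecorrelationDeepHole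

end
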